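import Summits.FinalStateConjecture.FinalStateConjecture.Theorems.NecksCertify.Negative.SeamedOneAtlasDeviation

/-!
# `NecksCertify` (crux stmt-FinalStateConjecture-13549, route StarvedNecks) — negative side:
# a SEAMED output has unbounded flat tubes

Prover seat `prover-line-stmt-FinalStateConjecture-13549-c3-0` (continuation lead c3 of the line
`two-cap-focusing-ledger`), 2026-08-16, realising the growth theorem (G1) that the generation-3
disprover `refuter-cdisprove-stmt-FinalStateConjecture-13549-g3-0` designed and documented in
`Cruxes/NecksCertify/Disproof.lean` §G but never landed (only its toolkit
`SeamedOneAtlasDeviation.lean`, p84363, reached the tree).  Sorry-free; Mathlib + the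
`KerrConvergence` API + that toolkit; no definitions, no named facts.

## Statement

`excision_tendsto_atTop_of_seamed`: for EVERY `FinalStateDecomposition d` (any `Cᵏ`), radii `R`
and `R₀` with clause (1) of the crux's `Hc` (`100·Mᵢ ≤ R₀`, orthochronous `Λᵢ`) and, out of the
crux's `Sm`, continuity of `Rᵢ` together with `ρᵢ ≥ R₀` (part of S1), ONE ATLAS (S6), S7, S8 and
S12 (all VERBATIM the clauses of `Sm`, in the `d.background` form of
`NecksCertifyFalseOfEqualVelocityBinaryWitness.false_of_parallel_boosts`), every excision radius
tends to infinity: `∀ j, Tendsto (d.excision j) atTop atTop`.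

Consequence (file `NecksCertifyFalseOfComovingPairWitness.lean`): the growth conjunct of the
landed hypothesis `H = EqualVelocityBinaryWitness` (p73407) is AUTOMATIC on seamed outputs, so
`¬ NecksCertify` holds modulo a bare comoving pair (`ComovingPairWitness`).

## Mechanism (all typed)

If `ρⱼ(s) < b` at a late flat time `s`, look just outside the tube wall on the pushed spin axis of
hole `j`, i.e. at `y = cⱼ + Λⱼ(t ∂₀ + λ ∂₃)` with `y⁰ = s` and `λ` slightly above `ρⱼ(s)`:
S8 at the wall point gives `Rⱼ ≥ ρⱼ(s) + 2` there and continuity of `Rⱼ` keeps `λ ≤ Rⱼ + 1`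
nearby; S12 + S8 keep every other tube away, so `y` is flat-late and lies in the OPEN set
`W = U₀ ∩ {y⁰ > τ₀} ∩ {rⱼ > r₊} ∩ {rⱼ < Rⱼ(tⱼ) + 1}` on which S7 makes S6 applicable: `Ψⱼ = Φ` on
`W`.  Hence (toolkit §3, `d(inclusion) = id`) the flat and the hole metric deviations at `y` differ
by the boosted Kerr–Schild term, whose `(Λⱼ∂₀, Λⱼ∂₀)` component on the axis is
`2H = 2Mⱼλ/(λ² + aⱼ²) ≥ 2MⱼR₀/((b+1)² + aⱼ²) > 0` (toolkit §1), while near-zone convergence of the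
hole chart at the FIXED radius `b + 1` and whole-slab convergence of the flat chart (STRUCTURE
fields, not `Sm`) make both deviations eventually smaller than any `ε` (toolkit §2) — the hole
time of `y` is affine in `s` with positive slope `1/(Λⱼ∂₀)⁰`, so it is late when `s` is.
-/

noncomputable section

open scoped Manifold ContDiff Topology ENNReal
open Filter Set Literature.Geometry.Lorentzian TopologicalSpace

namespace Summit.FinalStateConjecture.FinalStateConjecture.Theorems.NecksCertify.Negative

set_option linter.dupNamespace false

/-! ## §1 The pushed spin axis of a boosted hole: `y = c + Λ(t ∂₀ + λ ∂₃)` -/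

/-- Rest-frame coordinates of the pushed axis point: `Λ⁻¹(y − c) = t ∂₀ + λ ∂₃`. -/
theorem poincareInv_axisPoint (Λ : lorentzGroup) (c : E4) (t l : ℝ) :
    poincareInv Λ c (c + (Λ : E4 ≃L[ℝ] E4) (t • E4.basisVector 0 + l • E4.basisVector 3)) =
      t • E4.basisVector 0 + l • E4.basisVector 3 := by
  rw [poincareInv, add_sub_cancel_left, ContinuousLinearEquiv.symm_apply_apply]

/-- Flat time of the pushed axis point: `y⁰ = c⁰ + t (Λ∂₀)⁰ + λ (Λ∂₃)⁰`. -/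
theorem axisPoint_apply_zero (Λ : lorentzGroup) (c : E4) (t l : ℝ) :
    (c + (Λ : E4 ≃L[ℝ] E4) (t • E4.basisVector 0 + l • E4.basisVector 3)) 0 =
      c 0 + t * ((Λ : E4 ≃L[ℝ] E4) (E4.basisVector 0)) 0 +
        l * ((Λ : E4 ≃L[ℝ] E4) (E4.basisVector 3)) 0 := by
  rw [map_add, map_smul, map_smul, PiLp.add_apply, PiLp.add_apply, PiLp.smul_apply,
    PiLp.smul_apply, smul_eq_mul, smul_eq_mul, add_assoc]

/-- Hole time of the pushed axis point is the rest-frame time `t`. -/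
theorem time_axisPoint (Λ : lorentzGroup) (c : E4) (M a t l : ℝ) :
    (boostedKerrBackground Λ c M a).time
        (c + (Λ : E4 ≃L[ℝ] E4) (t • E4.basisVector 0 + l • E4.basisVector 3)) = t := by
  show (poincareInv Λ c _) 0 = t
  rw [poincareInv_axisPoint]
  simp

/-- Hole radius of the pushed axis point is `|λ|` (toolkit `kerr_radius_axis`). -/
theorem radius_axisPoint (Λ : lorentzGroup) (c : E4) (M a t l : ℝ) :
    (boostedKerrBackground Λ c M a).radius
        (c + (Λ : E4 ≃L[ℝ] E4) (t • E4.basisVector 0 + l • E4.basisVector 3)) = |l| := by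
  show Kerr.radius a (poincareInv Λ c _) = |l|
  rw [poincareInv_axisPoint, kerr_radius_axis]

/-- Above `2M ≥ r₊` the pushed axis point lies in the boosted Kerr exterior. -/
theorem axisPoint_mem_domain (Λ : lorentzGroup) (c : E4) {M : ℝ} (hM : 0 ≤ M) (a t : ℝ) {l : ℝ}
    (hl : 2 * M < l) :
    c + (Λ : E4 ≃L[ℝ] E4) (t • E4.basisVector 0 + l • E4.basisVector 3) ∈
      (boostedKerrBackground Λ c M a).domain := by
  show _ ∈ boostedKerrExterior Λ c M a
  have hl0 : 0 < l := by linarith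
  rw [mem_boostedKerrExterior, poincareInv_axisPoint, Kerr.mem_exterior, kerr_radius_axis,
    abs_of_pos hl0]
  exact max_lt ((rPlus_le_two_mul hM a).trans_lt hl) hl0

/-- On the pushed axis the boosted Kerr–Schild term in the direction `Λ∂₀` is
`2H = 2Mλ/(λ² + a²)` (toolkit `boostedKerrBilin_sub_bilin_lorentz_basisVector_zero`,
`scalarH_axis`). -/
theorem bilin_axisPoint_sub (Λ : lorentzGroup) (c : E4) (M a t : ℝ) {l : ℝ} (hl : 0 < l) :
    (boostedKerrBackground Λ c M a).bilin
          (c + (Λ : E4 ≃L[ℝ] E4) (t • E4.basisVector 0 + l • E4.basisVector 3))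
          ((Λ : E4 ≃L[ℝ] E4) (E4.basisVector 0)) ((Λ : E4 ≃L[ℝ] E4) (E4.basisVector 0)) -
        Minkowski.bilin ((Λ : E4 ≃L[ℝ] E4) (E4.basisVector 0))
          ((Λ : E4 ≃L[ℝ] E4) (E4.basisVector 0)) =
      2 * (M * l / (l ^ 2 + a ^ 2)) := by
  show boostedKerrBilin Λ c M a _ _ _ - _ = _
  rw [boostedKerrBilin_sub_bilin_lorentz_basisVector_zero, poincareInv_axisPoint,
    scalarH_axis M a t hl]

/-! ## §2 The growth theorem -/

/-- **SEAMED ⇒ UNBOUNDED FLAT TUBES (G1).**  For every final-state decomposition `d` (any `Cᵏ`),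
radii `R` and `R₀` with `Hc`(1) (`100·Mᵢ ≤ R₀`, orthochronous boosts), continuity of the `Rᵢ` and
`ρᵢ ≥ R₀` (from S1), ONE ATLAS (S6), S7, S8 and S12 of the crux's `Sm`, every excision radius
tends to infinity.  Uses of the structure: near-zone convergence of hole `j` at ONE fixed radius
(`tendsto_truncDeviationCk j (b+1)`), whole-slab flat convergence (`tendsto_deviationCk_flat`),
`setOf_lt_excision_subset_flatDomain`, smoothness of the two charts, `mass_pos`.  Not used:
S2–S5, S9–S11, monotonicity of `R`, sub-extremality.  Tightness: with BOUNDED tubes S8 and S12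
alone are consistent with comoving labels (`parallel_boosts_consistent_with_bounded_tubes` in the
disprover's workfile), so it is S6 + convergence that force the growth. -/
theorem excision_tendsto_atTop_of_seamed {𝓢 : Spacetime.{0} 4} {O : Set 𝓢.carrier} {k : ℕ}
    (d : FinalStateDecomposition 𝓢 O k) (R : Fin d.N → ℝ → ℝ) (R₀ : ℝ)
    (hc1 : ∀ i, Kerr.IsSubextremal (d.mass i) (d.spin i) ∧ 100 * d.mass i ≤ R₀ ∧
      0 < ((d.motion i).1 : E4 ≃L[ℝ] E4) (E4.basisVector 0) 0)
    (S1 : ∀ i, Continuous (R i) ∧ ∀ s, R₀ ≤ d.excision i s)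
    (S6 : ∀ i (y : E4) (hy : y ∈ (d.background i).domain), d.τ₀ ≤ y 0 →
      (∀ j, d.excision j (y 0) < (d.background j).radius y) →
      (d.background i).radius y ≤ R i ((d.background i).time y) + 1 →
      ∃ hy' : y ∈ d.flatDomain, d.chart i ⟨y, hy⟩ = d.flatChart ⟨y, hy'⟩)
    (S7 : ∀ y : d.flatDomain, d.τ₀ ≤ y.1 0 → ∀ j, d.excision j (y.1 0) < (d.background j).radius y.1)
    (S8 : ∀ j (y : E4), d.τ₀ ≤ y 0 → (d.background j).radius y ≤ d.excision j (y 0) →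
      (d.background j).radius y + 2 ≤ R j ((d.background j).time y))
    (S12 : ∀ j j' (y : E4), j ≠ j' → (d.τ₀ ≤ y 0 ∨ d.τ₀ ≤ (d.background j).time y) →
      (d.background j).radius y ≤ R j ((d.background j).time y) + 1 →
      R j' ((d.background j').time y) + 1 < (d.background j').radius y)
    (j : Fin d.N) : Tendsto (d.excision j) atTop atTop := by
  classical
  obtain ⟨-, hMR, hT0⟩ := hc1 j
  have hM : 0 < d.mass j := d.mass_pos j
  have hR₀ : 0 < R₀ := by linarith
  obtain ⟨hRcont, hρR₀⟩ := S1 j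
  by_contra hnot
  rw [tendsto_atTop_atTop] at hnot
  push Not at hnot
  obtain ⟨b, hb⟩ := hnot
  -- names for the pushed frame vectors `T = Λⱼ∂₀`, `E = Λⱼ∂₃`
  obtain ⟨T, hTdef⟩ : ∃ T : E4, ((d.motion j).1 : E4 ≃L[ℝ] E4) (E4.basisVector 0) = T := ⟨_, rfl⟩
  obtain ⟨E, hEdef⟩ : ∃ E : E4, ((d.motion j).1 : E4 ≃L[ℝ] E4) (E4.basisVector 3) = E := ⟨_, rfl⟩
  rw [hTdef] at hT0
  -- `R₀ < b`: a bad time exists at all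
  have hb0 : R₀ < b := by
    obtain ⟨s, -, hs⟩ := hb 0
    exact (hρR₀ s).trans_lt hs
  -- the positive Kerr–Schild floor `c₀` and the tolerance `ε`
  set c₀ : ℝ := 2 * (d.mass j * R₀ / ((b + 1) ^ 2 + d.spin j ^ 2)) with hc₀
  have hden : 0 < (b + 1) ^ 2 + d.spin j ^ 2 := by nlinarith [sq_nonneg (d.spin j)]
  have hc₀pos : 0 < c₀ := by
    have := div_pos (mul_pos hM hR₀) hden
    linarith
  set ε : ℝ := c₀ / (4 * (‖T‖ ^ 2 + 1)) with hεdef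
  have hεpos : 0 < ε := by positivity
  -- thresholds from the two STRUCTURE convergences
  obtain ⟨NF, hNF⟩ := eventually_atTop.1
    (d.tendsto_deviationCk_flat.eventually (ge_mem_nhds (ENNReal.ofReal_pos.2 hεpos)))
  obtain ⟨NH, hNH⟩ := eventually_atTop.1
    ((d.tendsto_truncDeviationCk j (b + 1)).eventually (ge_mem_nhds (ENNReal.ofReal_pos.2 hεpos)))
  -- a late bad flat time `s`
  obtain ⟨s, hsN, hsb⟩ :=
    hb (max (max (d.τ₀ + 1) NF) (NH * T 0 + (d.motion j).2 0 + |E 0| * (b + 1)))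
  have hmax1 := le_max_left (max (d.τ₀ + 1) NF) (NH * T 0 + (d.motion j).2 0 + |E 0| * (b + 1))
  have hmax2 := le_max_right (max (d.τ₀ + 1) NF) (NH * T 0 + (d.motion j).2 0 + |E 0| * (b + 1))
  have hmax3 := le_max_left (d.τ₀ + 1) NF
  have hmax4 := le_max_right (d.τ₀ + 1) NF
  have hsτ : d.τ₀ < s := by linarith
  have hsF : NF ≤ s := by linarith
  have hsH : NH * T 0 + (d.motion j).2 0 + |E 0| * (b + 1) ≤ s := by linarith
  obtain ⟨ρ, hρdef⟩ : ∃ ρ : ℝ, d.excision j s = ρ := ⟨_, rfl⟩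
  have hρ₀ : R₀ ≤ ρ := hρdef ▸ hρR₀ s
  have hρb : ρ < b := hρdef ▸ hsb
  have hρpos : 0 < ρ := hR₀.trans_le hρ₀
  have h2M : 2 * d.mass j < ρ := by linarith
  -- the pushed axis points at flat time `s`: `Y l = cⱼ + Λⱼ (t(l) ∂₀ + l ∂₃)`
  obtain ⟨Y, hY⟩ : ∃ Y : ℝ → E4, ∀ l, Y l = (d.motion j).2 + ((d.motion j).1 : E4 ≃L[ℝ] E4)
      (((s - (d.motion j).2 0 - l * E 0) / T 0) • E4.basisVector 0 + l • E4.basisVector 3) :=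
    ⟨_, fun _ ↦ rfl⟩
  have hYtime : ∀ l, (d.background j).time (Y l) = (s - (d.motion j).2 0 - l * E 0) / T 0 := by
    intro l
    rw [hY]
    exact time_axisPoint _ _ _ _ _ _
  have hYrad : ∀ l, (d.background j).radius (Y l) = |l| := by
    intro l
    rw [hY]
    exact radius_axisPoint _ _ _ _ _ _
  have hY0 : ∀ l, Y l 0 = s := by
    intro l
    rw [hY, axisPoint_apply_zero, hTdef, hEdef, div_mul_cancel₀ _ hT0.ne']
    ring
  have hYmem : ∀ l, ρ ≤ l → Y l ∈ (d.background j).domain := by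
    intro l hl
    rw [hY]
    exact axisPoint_mem_domain _ _ hM.le _ _ (h2M.trans_le hl)
  have hYbilin : ∀ l, 0 < l → (d.background j).bilin (Y l) T T - Minkowski.bilin T T =
      2 * (d.mass j * l / (l ^ 2 + d.spin j ^ 2)) := by
    intro l hl
    rw [hY, ← hTdef]
    exact bilin_axisPoint_sub _ _ _ _ _ hl
  -- S8 at the wall point `l = ρ`: `Rⱼ ≥ ρ + 2` there
  have hwall : ρ + 2 ≤ R j ((s - (d.motion j).2 0 - ρ * E 0) / T 0) := by
    have h8 := S8 j (Y ρ) (by rw [hY0]; exact hsτ.le)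
      (by rw [hYrad, hY0, hρdef, abs_of_pos hρpos])
    rwa [hYrad, abs_of_pos hρpos, hYtime] at h8
  -- continuity of `Rⱼ` along the axis family keeps `Rⱼ > ρ + 3/2` for `l` near `ρ`
  have hcont : Continuous fun l : ℝ ↦ R j ((s - (d.motion j).2 0 - l * E 0) / T 0) :=
    hRcont.comp (by fun_prop)
  have hev : ∀ᶠ l in 𝓝 ρ, ρ + 3 / 2 < R j ((s - (d.motion j).2 0 - l * E 0) / T 0) :=
    hcont.continuousAt.eventually
      (lt_mem_nhds (show ρ + 3 / 2 < R j ((s - (d.motion j).2 0 - ρ * E 0) / T 0) by linarith))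
  obtain ⟨δ, hδpos, hδ⟩ := Metric.eventually_nhds_iff.1 hev
  obtain ⟨l₁, hl₁ρ, hl₁δ, hl₁half⟩ : ∃ l₁ : ℝ, ρ < l₁ ∧ dist l₁ ρ < δ ∧ l₁ ≤ ρ + 1 / 2 := by
    have hm : 0 < min (δ / 2) (1 / 2) := lt_min (by linarith) (by norm_num)
    refine ⟨ρ + min (δ / 2) (1 / 2), by linarith, ?_, by linarith [min_le_right (δ / 2) (1 / 2 : ℝ)]⟩
    rw [Real.dist_eq, add_sub_cancel_left, abs_of_pos hm]
    exact (min_le_left _ _).trans_lt (by linarith)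
  have hR₁ : ρ + 3 / 2 < R j ((d.background j).time (Y l₁)) := by
    rw [hYtime]
    exact hδ hl₁δ
  -- the witness point `y₁ = Y l₁`
  have hl₁pos : 0 < l₁ := hρpos.trans hl₁ρ
  have hl₁b : l₁ ≤ b + 1 := by linarith
  have hrad₁ : (d.background j).radius (Y l₁) = l₁ := by rw [hYrad, abs_of_pos hl₁pos]
  have h01 : Y l₁ 0 = s := hY0 l₁
  have hfit : (d.background j).radius (Y l₁) ≤ R j ((d.background j).time (Y l₁)) + 1 := by
    rw [hrad₁]
    linarith
  -- `y₁` is outside every flat tube at flat time `s` (S12 + S8 for the other holes)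
  have hout : ∀ i, d.excision i (Y l₁ 0) < (d.background i).radius (Y l₁) := by
    intro i
    rcases eq_or_ne i j with rfl | hij
    · rw [h01, hρdef, hrad₁]
      exact hl₁ρ
    · have h12 := S12 j i (Y l₁) (Ne.symm hij) (Or.inl (by rw [h01]; exact hsτ.le)) hfit
      by_contra hin
      have h8 := S8 i (Y l₁) (by rw [h01]; exact hsτ.le) (not_lt.1 hin)
      linarith
  have hflat : Y l₁ ∈ d.flatDomain :=
    d.setOf_lt_excision_subset_flatDomain ⟨by rw [h01]; exact hsτ, fun i ↦ hout i⟩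
  -- the OPEN set on which S6 applies (S7 supplies the tube condition, `U₀` is open)
  have hradcont : Continuous (d.background j).radius :=
    (Kerr.continuous_radius _).comp (continuous_poincareInv _ _)
  have hRt : Continuous fun z : E4 ↦ R j ((d.background j).time z) :=
    hRcont.comp ((PiLp.continuous_apply 2 _ 0).comp (continuous_poincareInv _ _))
  obtain ⟨W, hWmem⟩ : ∃ W : Opens E4, ∀ z : E4, z ∈ W ↔
      z ∈ d.flatDomain ∧ d.τ₀ < z 0 ∧ z ∈ (d.background j).domain ∧
        (d.background j).radius z < R j ((d.background j).time z) + 1 :=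
    ⟨d.flatDomain ⊓ ⟨{z : E4 | d.τ₀ < z 0}, isOpen_lt continuous_const (PiLp.continuous_apply 2 _ 0)⟩ ⊓
        (d.background j).domain ⊓
        ⟨{z : E4 | (d.background j).radius z < R j ((d.background j).time z) + 1},
          isOpen_lt hradcont (hRt.add continuous_const)⟩,
      fun z ↦ by simp only [Opens.mem_inf, Opens.mem_mk, Set.mem_setOf_eq, and_assoc]⟩
  have hW1 : W ≤ (d.background j).domain := fun z hz ↦ ((hWmem z).1 hz).2.2.1
  have hW2 : W ≤ d.flatDomain := fun z hz ↦ ((hWmem z).1 hz).1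
  have hagree : ∀ (z : E4) (hz : z ∈ W), d.chart j ⟨z, hW1 hz⟩ = d.flatChart ⟨z, hW2 hz⟩ := by
    intro z hz
    obtain ⟨hzU, hzτ, hzB, hzR⟩ := (hWmem z).1 hz
    obtain ⟨_, heq⟩ := S6 j z hzB hzτ.le (S7 ⟨z, hzU⟩ hzτ.le) hzR.le
    exact heq
  have hyW : Y l₁ ∈ W := by
    refine (hWmem _).2 ⟨hflat, by rw [h01]; exact hsτ, hYmem l₁ hl₁ρ.le, ?_⟩
    rw [hrad₁]
    linarith
  -- ONE ATLAS at `y₁`: `|g_B(T,T) − η(T,T)| ≤ (‖dev Φ‖ + ‖dev Ψⱼ‖)‖T‖²`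
  have key := abs_sub_bilin_le_of_agree (d.background j) (d.chart j) (d.isLateChart j).contMDiff
    d.flatDomain d.flatChart d.isLateChart_flat.contMDiff W hW1 hW2 hagree hyW T
  -- the two deviations are `≤ ε` (late flat slab `s ≥ NF`; late hole time `≥ NH` at radius `≤ b+1`)
  have hdevF : ‖𝓢.deviation (Minkowski.backgroundOn d.flatDomain) d.flatChart ⟨Y l₁, hW2 hyW⟩‖ ≤ ε :=
    norm_deviation_le_of_supCkENorm_le (Minkowski.backgroundOn d.flatDomain) d.flatChart
      (S := (Minkowski.backgroundOn d.flatDomain).timeSlab s) (k := k) hεpos.le (hNF s hsF)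
      (show Y l₁ 0 = s from h01)
  have htime : NH ≤ (d.background j).time (Y l₁) := by
    rw [hYtime, le_div_iff₀ hT0]
    have h1 : l₁ * E 0 ≤ (b + 1) * |E 0| :=
      calc l₁ * E 0 ≤ l₁ * |E 0| := mul_le_mul_of_nonneg_left (le_abs_self _) hl₁pos.le
        _ ≤ (b + 1) * |E 0| := mul_le_mul_of_nonneg_right hl₁b (abs_nonneg _)
    linarith
  have hdevH : ‖𝓢.deviation (d.background j) (d.chart j) ⟨Y l₁, hW1 hyW⟩‖ ≤ ε :=
    norm_deviation_le_of_supCkENorm_le (d.background j) (d.chart j)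
      (S := (d.background j).truncTimeSlab (b + 1) ((d.background j).time (Y l₁))) (k := k)
      hεpos.le (hNH _ htime) (show _ = _ ∧ _ ≤ _ from ⟨rfl, by rw [hrad₁]; exact hl₁b⟩)
  -- the Kerr–Schild floor against the two small deviations
  have hfloor : c₀ ≤ (d.background j).bilin (Y l₁) T T - Minkowski.bilin T T := by
    rw [hYbilin l₁ hl₁pos, hc₀]
    have := axis_scalarH_lower (a := d.spin j) hM.le hR₀ (hρ₀.trans hl₁ρ.le) hl₁b
    linarith
  have hle : c₀ ≤ (ε + ε) * ‖T‖ ^ 2 :=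
    calc c₀ ≤ |(d.background j).bilin (Y l₁) T T - Minkowski.bilin T T| :=
          hfloor.trans (le_abs_self _)
      _ ≤ _ := key
      _ ≤ (ε + ε) * ‖T‖ ^ 2 :=
          mul_le_mul_of_nonneg_right (add_le_add hdevF hdevH) (sq_nonneg _)
  have hlt : (ε + ε) * ‖T‖ ^ 2 < c₀ := by
    have hX : 0 < ‖T‖ ^ 2 + 1 := by positivity
    have h1 : (ε + ε) * ‖T‖ ^ 2 = c₀ * (‖T‖ ^ 2 / (2 * (‖T‖ ^ 2 + 1))) := by
      rw [hεdef]
      field_simp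
      ring
    have h2 : ‖T‖ ^ 2 / (2 * (‖T‖ ^ 2 + 1)) < 1 := by
      rw [div_lt_one (by positivity)]
      linarith
    rw [h1]
    calc c₀ * (‖T‖ ^ 2 / (2 * (‖T‖ ^ 2 + 1))) < c₀ * 1 := mul_lt_mul_of_pos_left h2 hc₀pos
      _ = c₀ := mul_one _
  linarith

end Summit.FinalStateConjecture.FinalStateConjecture.Theorems.NecksCertify.Negative

end
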